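import Summits.BirchSwinnertonDyer.BirchSwinnertonDyer.Theorems.ManinLocalTwoThreeHalvingParamDictionary
import Summits.BirchSwinnertonDyer.BirchSwinnertonDyer.Theorems.ManinLocalTwoThreeKummerCubeAnalyticLocalParam
import Literature.NumberTheory.EllipticCurves.GlobalMinimalModel
import HarnessLib

/-!
# The `x`-coordinate of the `c`-DIVISION POINT `H = u_W(ℰ_f)` near the cusp: `𝕢²·x_W(H)` is an INTEGER `q`-series
(route `ManinLocalTwoThree`, cruxes C2 `ManinOddAtFour` stmt-BirchSwinnertonDyer-22967 / C3 `ManinPrimeToThreeAtNine`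
stmt-BirchSwinnertonDyer-22968; cell bsd-f2-manin, prover p3 gen 18; -an g44's c-division witness, node N7 `CDivCuspSeries` core)

-an g44 (STATUS/INBOX 2026-08-30T00:06Z) replaces the `p`-division witnesses of the halving/thirding lines by the `c`-DIVISION WITNESS
`F = 12·℘_{Λ_W}(ℰ_f)·B_d·Δ^a`: the `x`-coordinate of `H(τ) := u_W(ℰ_f(τ))` (`[c]H = φ`), whose `q`-expansion is integral by HONDA AT
THE MULTIPLIER `1` (`t_W(H) = exp_W(Σ aₙqⁿ/n) = q + … ∈ qℤ⟦q⟧` has LEADING COEFFICIENT `1`, so `x = (t²x)/t²` stays integral).  This file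
PROVES the cusp-series core (no definition, no sorry):
* `exists_qGerm_locG` — `G := (t²x)∘ε` is an analytic `q`-germ, `G(0) = 1`, `𝓣[G] = (X²x)_W(exp_W(Σ aₙqⁿ/n)) ⊗ ℂ`, `G(𝕢₁τ) = (t_W²x_W)(ℰ_f τ)`
  (tree `taylorAt0_locG` + `taylorAt0_comp`);
* `exists_intSeries_taylor_xGerm` — the unit `U := 𝓣[t_W(H)]/X ∈ 1 + qℤ⟦q⟧` and the INTEGER series `P := (X²x)_W(exp_W ℓ)·U⁻² ∈ ℤ⟦q⟧`;
* `exists_hasSum_qParam_sq_mul_x` — **N7 core**: `∃ P ∈ ℤ⟦X⟧, B : Im τ > B ⟹ Σ Pₘ 𝕢₁(τ)ᵐ = 𝕢₁(τ)²·(℘_{Λ_W}(ℰ_f τ) − b₂/12)`;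
* `exists_hasSum_qParam_sq_mul_twelve_weierstrassP` — the same for `𝕢₁(τ)²·12℘_{Λ_W}(ℰ_f τ)` (`12·b₂/12 = b₂ ∈ ℤ`).
HONEST FRAMING: bookkeeping toward -an's node N7; the witness law, C2/C3, Manin's conjecture and BSD are NOT proved here.
[cite: Honda1970, Thm. 9] [cite: SilvermanAEC2009, IV.1 and IV.5.5]
-/

set_option autoImplicit false
-- lint-debt: the directory name repeats the summit name (sibling precedent `ManinLocalTwoThreeHalvingParamDictionary.lean`)
set_option linter.dupNamespace false

noncomputable section

open scoped Topology PeriodPair MatrixGroups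
open Complex Filter PowerSeries CongruenceSubgroup
open UpperHalfPlane hiding I
open WeierstrassCurve Literature.NumberTheory.EllipticCurves Literature.NumberTheory.EllipticCurves.ModularForms
open Summit.BirchSwinnertonDyer.Rank1Residual.ManinAdditive.CuspidalKummer
open Summit.BirchSwinnertonDyer.Rank1Residual.ManinAdditive.CuspidalKummerThree
open Summit.BirchSwinnertonDyer.BirchSwinnertonDyer.Theorems.ManinLocalTwoThree.KummerCubeAnalytic
open Summit.BirchSwinnertonDyer.BirchSwinnertonDyer.Theorems.ManinLocalTwoThree.HalvingParam

namespace Summit.BirchSwinnertonDyer.BirchSwinnertonDyer.Theorems.ManinLocalTwoThree.CDivCuspGerm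

/-! ## §1 The germ `(t²x)∘ε` -/

/-- **`G = (t_W²·x_W)∘ε` is an analytic `q`-germ** with `G(0) = 1`, `𝓣[G] = (X²x)_W(exp_W(Σ aₙqⁿ/n)) ⊗ ℂ` and
`G(𝕢₁τ) = locG(ℰ_f τ)`. [cite: SilvermanAEC2009, IV.1] -/
theorem exists_qGerm_locG (W : WeierstrassCurve ℚ) [W.IsElliptic] {N : ℕ} [NeZero N]
    (D : ModularParametrizationData W N) (a : ℕ → ℤ) (ha : ∀ n, (a n : ℂ) = cuspCoeff D.f n) :
    ∃ G : ℂ → ℂ, AnalyticAt ℂ G 0 ∧ G 0 = 1 ∧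
      taylorAt0 G = PowerSeries.map (algebraMap ℚ ℂ)
        (W.formalXMulSq.subst (W.formalExp.subst (lSeriesLog a)) : ℚ⟦X⟧) ∧
      ∀ τ : ℍ, G (Function.Periodic.qParam 1 (τ : ℂ)) = locG D.L (W.baseChange ℂ) (eichlerIntegral D.f τ) := by
  set V := W.baseChange ℂ with hV
  obtain ⟨h₂, h₃⟩ := D.isNeronLattice
  rw [← hV] at h₂ h₃
  have hε : AnalyticAt ℂ (qGerm D.f) 0 := analyticAt_qGerm D.f
  have hε0 : qGerm D.f 0 = 0 := qGerm_zero D.f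
  have hga : AnalyticAt ℂ (locG D.L V) 0 := analyticAt_locG D.L V
  refine ⟨locG D.L V ∘ qGerm D.f, ?_, ?_, ?_, ?_⟩
  · have h' : AnalyticAt ℂ (locG D.L V) (qGerm D.f 0) := by rw [hε0]; exact hga
    exact h'.comp hε
  · rw [Function.comp_apply, hε0, locG, if_pos (zero_mem _)]
  · have hL0 : constantCoeff (lSeriesLog a) = 0 := by
      rw [← coeff_zero_eq_constantCoeff_apply, lSeriesLog, coeff_mk]
      simp
    have hsL : HasSubst (lSeriesLog a) := HasSubst.of_constantCoeff_zero' hL0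
    have hE0 : constantCoeff (W.formalExp.subst (lSeriesLog a)) = 0 :=
      PowerSeries.constantCoeff_subst_eq_zero hL0 _ W.constantCoeff_formalExp
    have hsE : HasSubst (W.formalExp.subst (lSeriesLog a)) := HasSubst.of_constantCoeff_zero' hE0
    have hsEV : HasSubst V.formalExp := HasSubst.of_constantCoeff_zero' V.constantCoeff_formalExp
    have hmapL : (lSeriesLog a).map (algebraMap ℚ ℂ) = taylorAt0 (qGerm D.f) := by
      rw [taylorAt0_qGerm]
      ext n
      rw [coeff_map, lSeriesLog, coeff_mk, coeff_mk, ← ha n]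
      simp
    have hT0 : constantCoeff (taylorAt0 (qGerm D.f)) = 0 := by rw [constantCoeff_taylorAt0, hε0]
    have hsT : HasSubst (taylorAt0 (qGerm D.f)) := HasSubst.of_constantCoeff_zero' hT0
    rw [taylorAt0_comp hga hε hε0, taylorAt0_locG D.L V h₂ h₃, PowerSeries.subst_comp_subst_apply hsEV hsT,
      map_subst_univ hsE, map_subst_univ hsL, hmapL, hV, WeierstrassCurve.baseChange, WeierstrassCurve.map_formalExp,
      WeierstrassCurve.map_formalXMulSq]
  · intro τ
    simp [qGerm_apply]

/-! ## §2 The integer Taylor series of `𝕢²·x_W(H)` -/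

/-- `map` commutes with one-variable substitution, `ℤ → ℚ`. [folklore] -/
theorem map_subst_int {f g : ℤ⟦X⟧} (hg : HasSubst g) :
    PowerSeries.map (Int.castRingHom ℚ) (f.subst g) =
      (PowerSeries.map (Int.castRingHom ℚ) f).subst (PowerSeries.map (Int.castRingHom ℚ) g) := by
  change MvPowerSeries.map (Int.castRingHom ℚ) (f.subst g) = _
  rw [PowerSeries.map_subst hg]
  rfl

/-- A rational power series all of whose coefficients are integers is the image of an integer power series. [folklore] -/
theorem exists_map_eq_of_forall_int {g : ℚ⟦X⟧} (hg : ∀ n, ∃ k : ℤ, coeff n g = (k : ℚ)) :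
    ∃ G : ℤ⟦X⟧, G.map (Int.castRingHom ℚ) = g := by
  choose k hk using hg
  refine ⟨PowerSeries.mk k, ?_⟩
  ext n
  rw [coeff_map, coeff_mk, hk n]
  rfl

/-- **The integer series of `𝕢²·x_W(H)`.**  With `Z := exp_W(Σ aₙqⁿ/n) ∈ qℤ⟦q⟧` (Honda at `1`), `[q¹]Z = a₁ = 1`: `Z = X·U` with
`U ∈ 1 + qℤ⟦q⟧` a unit, and `P := (X²x)_W(Z)·U⁻² ∈ ℤ⟦q⟧` satisfies `P·U² = (X²x)_W(Z)` over `ℚ`. [cite: Honda1970, Thm. 9]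
[cite: SilvermanAEC2009, IV.1] -/
theorem exists_intSeries_taylor_xGerm (W : WeierstrassCurve ℚ) [W.IsElliptic] [W.IsGloballyMinimal] {N : ℕ} [NeZero N]
    (D : ModularParametrizationData W N) (a : ℕ → ℤ) (ha : ∀ n, (a n : ℂ) = cuspCoeff D.f n) :
    ∃ (P U : ℤ⟦X⟧), constantCoeff U = 1 ∧
      W.formalExp.subst (lSeriesLog a) = X * U.map (Int.castRingHom ℚ) ∧
      P.map (Int.castRingHom ℚ) * U.map (Int.castRingHom ℚ) ^ 2 = W.formalXMulSq.subst (W.formalExp.subst (lSeriesLog a)) := by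
  set Z : ℚ⟦X⟧ := W.formalExp.subst (lSeriesLog a) with hZ
  have hf1 : cuspCoeff D.f 1 = 1 := D.isNewformOf.1.2.2
  have ha1 : a 1 = 1 := by
    have h := ha 1
    rw [hf1] at h
    exact_mod_cast h
  -- Honda at `1`
  have hZint : ∀ n, ∃ k : ℤ, coeff n Z = (k : ℚ) := fun n ↦ by
    have h := exists_int_coeff_expSeries_intMul W D a ha 1 n
    rwa [Int.cast_one, one_smul] at h
  obtain ⟨Zℤ, hZℤ⟩ := exists_map_eq_of_forall_int hZint
  have hL0 : constantCoeff (lSeriesLog a) = 0 := by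
    rw [← coeff_zero_eq_constantCoeff_apply, lSeriesLog, coeff_mk]
    simp
  have hZ0 : constantCoeff Z = 0 := PowerSeries.constantCoeff_subst_eq_zero hL0 _ W.constantCoeff_formalExp
  have hE1 : coeff 1 W.formalExp = 1 := by
    have h := congrArg (coeff 1) W.formalLog_subst_formalExp
    rwa [coeff_one_subst_eq_mul _ W.constantCoeff_formalExp, coeff_one_formalLog, one_mul, coeff_one_X] at h
  have hZ1 : coeff 1 Z = 1 := by
    rw [hZ, coeff_one_subst_eq_mul _ hL0, hE1, one_mul, lSeriesLog, coeff_mk, ha1]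
    simp
  have hZℤ0 : constantCoeff Zℤ = 0 := by
    have h := hZ0
    rw [← hZℤ, ← coeff_zero_eq_constantCoeff_apply, coeff_map, coeff_zero_eq_constantCoeff_apply] at h
    simpa using h
  have hZℤ1 : coeff 1 Zℤ = 1 := by
    have h := hZ1
    rw [← hZℤ, coeff_map] at h
    simpa using h
  -- `Z = X·U`
  set U : ℤ⟦X⟧ := PowerSeries.mk fun p ↦ coeff (p + 1) Zℤ with hU
  have hZU : Zℤ = X * U := by
    have h := PowerSeries.eq_X_mul_shift_add_const Zℤ
    rw [hZℤ0, map_zero, add_zero] at h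
    exact h
  have hU1 : constantCoeff U = 1 := by
    rw [← coeff_zero_eq_constantCoeff_apply, hU, coeff_mk, zero_add, hZℤ1]
  -- the integral model and `(X²x)_W(Z) ∈ ℤ⟦q⟧`
  set Wℤ : WeierstrassCurve ℤ := integralModelInt W with hWℤ
  have hWmap : Wℤ.map (Int.castRingHom ℚ) = W := map_integralModelInt W
  have hsZℤ : HasSubst Zℤ := HasSubst.of_constantCoeff_zero' hZℤ0
  have hGint : PowerSeries.map (Int.castRingHom ℚ) (Wℤ.formalXMulSq.subst Zℤ) = W.formalXMulSq.subst Z := by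
    rw [map_subst_int hsZℤ, WeierstrassCurve.map_formalXMulSq, hWmap, hZℤ]
  -- the unit `U` and its inverse
  have hUu : constantCoeff U = ((1 : ℤˣ) : ℤ) := by rw [hU1, Units.val_one]
  have hUinv : U * PowerSeries.invOfUnit U 1 = 1 := PowerSeries.mul_invOfUnit U 1 hUu
  refine ⟨Wℤ.formalXMulSq.subst Zℤ * PowerSeries.invOfUnit U 1 ^ 2, U, hU1, ?_, ?_⟩
  · rw [← hZℤ, hZU, map_mul, map_X]
  · rw [map_mul, map_pow, mul_assoc, ← mul_pow, ← map_mul, mul_comm (PowerSeries.invOfUnit U 1), hUinv, map_one, one_pow,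
      mul_one]
    exact hGint

/-! ## §3 N7 core: `𝕢²·x_W(H)` is an integer `q`-series near `i∞` -/

/-- **N7 core — `𝕢₁(τ)²·x_W(H(τ))` is an INTEGER `q`-series near the cusp**: there are `P ∈ ℤ⟦X⟧` and `B` with
`Σₘ Pₘ 𝕢₁(τ)ᵐ = 𝕢₁(τ)²·(℘_{Λ_W}(ℰ_f(τ)) − b₂/12)` for `Im τ > B` (`H(τ) = u_W(ℰ_f τ)`, `x_W(H) = ℘_{Λ_W}(ℰ_f) − b₂/12`; Honda at the
multiplier `1`). [cite: Honda1970, Thm. 9] [cite: SilvermanAEC2009, IV.1] -/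
theorem exists_hasSum_qParam_sq_mul_x (W : WeierstrassCurve ℚ) [W.IsElliptic] [W.IsGloballyMinimal] {N : ℕ} [NeZero N]
    (D : ModularParametrizationData W N) :
    ∃ (P : ℤ⟦X⟧) (B : ℝ), ∀ τ : ℍ, B < τ.im →
      HasSum (fun m : ℕ ↦ ((coeff m P : ℤ) : ℂ) * Function.Periodic.qParam 1 (τ : ℂ) ^ m)
        (Function.Periodic.qParam 1 (τ : ℂ) ^ 2 * (℘[D.L] (eichlerIntegral D.f τ) - (W.b₂ : ℂ) / 12)) := by
  classical
  set V := W.baseChange ℂ with hV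
  set a : ℕ → ℤ := fun n ↦ W.LFunction n with hadef
  have ha : ∀ n, (a n : ℂ) = cuspCoeff D.f n := fun n ↦ by rw [D.isNewformOf.2 n]
  have hf1 : cuspCoeff D.f 1 = 1 := D.isNewformOf.1.2.2
  -- the two germs
  obtain ⟨G, hGan, hG0, hTG, hGval⟩ := exists_qGerm_locG W D a ha
  obtain ⟨Z, hZan, hZ0, hTZ, hZval⟩ := exists_qGerm_locT_intMul W D a ha 1
  obtain ⟨P, U, hU1, hZU, hPU⟩ := exists_intSeries_taylor_xGerm W D a ha
  simp only [Int.cast_one, one_smul] at hTZ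
  -- `Z = q·Uf`, `Uf := dslope Z 0` analytic with `Uf 0 = 1`
  set Uf : ℂ → ℂ := dslope Z 0 with hUf
  have hZq : ∀ q, Z q = q * Uf q := fun q ↦ by
    have h := sub_smul_dslope Z 0 q
    rw [sub_zero, hZ0, sub_zero, smul_eq_mul] at h
    exact h.symm
  have hUfan : AnalyticAt ℂ Uf 0 := by
    obtain ⟨p, hp⟩ := hZan
    exact ⟨_, hp.has_fpower_series_dslope_fslope⟩
  have hTUmap : taylorAt0 Uf = (U.map (Int.castRingHom ℚ)).map (algebraMap ℚ ℂ) := by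
    have h1 : taylorAt0 Z = X * taylorAt0 Uf := by
      have hfun : Z = (fun q : ℂ ↦ q) * Uf := by funext q; rw [Pi.mul_apply]; exact hZq q
      have hid : AnalyticAt ℂ (fun q : ℂ ↦ q) 0 := analyticAt_id
      have h := congrArg taylorAt0 hfun
      simp only [taylorAt0] at h ⊢
      rw [Literature.NumberTheory.Transcendental.AndreCriterion.taylor_mul hid hUfan] at h
      rw [h]
      congr 1
      exact taylorAt0_id
    have h2 : taylorAt0 Z = X * (U.map (Int.castRingHom ℚ)).map (algebraMap ℚ ℂ) := by
      rw [hTZ, hZU, map_mul, map_X]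
    exact mul_left_cancel₀ X_ne_zero (h1.symm.trans h2)
  have hUf0 : Uf 0 = 1 := by
    have h := constantCoeff_taylorAt0 Uf
    rw [hTUmap, ← coeff_zero_eq_constantCoeff_apply, coeff_map, coeff_map, coeff_zero_eq_constantCoeff_apply, hU1] at h
    simpa using h.symm
  -- the germ `Xq := G/Uf²`
  set Xq : ℂ → ℂ := fun q ↦ G q / Uf q ^ 2 with hXq
  have hXqan : AnalyticAt ℂ Xq 0 := hGan.div (hUfan.pow 2) (by rw [hUf0]; norm_num)
  have hTXq : taylorAt0 Xq = (P.map (Int.castRingHom ℚ)).map (algebraMap ℚ ℂ) := by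
    have hprod : taylorAt0 Xq * taylorAt0 Uf ^ 2 = taylorAt0 G := by
      have hUfne : ∀ᶠ q in 𝓝 (0 : ℂ), Uf q ≠ 0 := hUfan.continuousAt.eventually_ne (by rw [hUf0]; exact one_ne_zero)
      have hfun : G =ᶠ[𝓝 0] Xq * Uf ^ 2 := by
        filter_upwards [hUfne] with q hq
        rw [Pi.mul_apply, Pi.pow_apply, hXq]
        field_simp
      have h := Literature.NumberTheory.Transcendental.AndreCriterion.taylor_congr hfun
      simp only [taylorAt0] at h ⊢
      rw [Literature.NumberTheory.Transcendental.AndreCriterion.taylor_mul hXqan (hUfan.pow 2),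
        Literature.NumberTheory.Transcendental.AndreCriterion.taylor_pow hUfan 2] at h
      exact h.symm
    rw [hTUmap, hTG, ← hPU, map_mul, map_pow] at hprod
    have hUne : ((U.map (Int.castRingHom ℚ)).map (algebraMap ℚ ℂ)) ^ 2 ≠ 0 := by
      refine pow_ne_zero 2 fun h0 ↦ ?_
      have h := congrArg constantCoeff h0
      rw [← coeff_zero_eq_constantCoeff_apply, coeff_map, coeff_map, coeff_zero_eq_constantCoeff_apply, hU1, map_zero] at h
      simp at h
    exact mul_right_cancel₀ hUne hprod
  -- near `q = 0`
  obtain ⟨r, hr, hsum⟩ := exists_hasSum_taylorAt0 hXqan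
  have hUfne' : ∀ᶠ q in 𝓝 (0 : ℂ), Uf q ≠ 0 := hUfan.continuousAt.eventually_ne (by rw [hUf0]; exact one_ne_zero)
  have hev : ∀ᶠ q in 𝓝[≠] (0 : ℂ), HasSum (fun m : ℕ ↦ coeff m (taylorAt0 Xq) * q ^ m) (Xq q) ∧ Uf q ≠ 0 ∧
      qGerm D.f q ∉ D.L.lattice := by
    have h1 : ∀ᶠ q in 𝓝 (0 : ℂ), ‖q‖ < r := by
      have : Metric.ball (0 : ℂ) r ∈ 𝓝 (0 : ℂ) := Metric.ball_mem_nhds 0 hr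
      filter_upwards [this] with q hq
      rwa [Metric.mem_ball, dist_zero_right] at hq
    filter_upwards [(h1.and hUfne').filter_mono nhdsWithin_le_nhds, eventually_qGerm_notMem D.f hf1 D.L] with q hq hqΛ
    exact ⟨hsum q hq.1, hq.2, hqΛ⟩
  obtain ⟨B, hB⟩ := exists_im_bound_of_eventually hev
  refine ⟨P, B, fun τ hτ ↦ ?_⟩
  obtain ⟨hS, hUq, hΛ⟩ := hB τ hτ
  set q := Function.Periodic.qParam 1 (τ : ℂ) with hq
  have hEq : qGerm D.f q = eichlerIntegral D.f τ := qGerm_apply D.f τ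
  rw [hEq] at hΛ
  -- `q²·x = G/Uf²`
  have hZval' : Z q = locT D.L V (eichlerIntegral D.f τ) := by simpa [hq] using hZval τ
  have hval : Xq q = q ^ 2 * (℘[D.L] (eichlerIntegral D.f τ) - (W.b₂ : ℂ) / 12) := by
    have hG := hGval τ
    rw [← hq, locG, if_neg hΛ, ← hZval'] at hG
    have hb₂ : V.b₂ = (W.b₂ : ℂ) := by rw [hV, WeierstrassCurve.baseChange, WeierstrassCurve.map_b₂]; rfl
    have hUq' : Uf q ≠ 0 := hUq
    rw [hXq]
    simp only
    rw [hG, hZq q, hb₂]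
    field_simp
  rw [← hval]
  rw [hTXq] at hS
  convert hS using 2 with m
  rw [coeff_map, coeff_map]
  simp

/-- **N7 core, `12℘` form**: `𝕢₁(τ)²·12℘_{Λ_W}(ℰ_f τ)` is an INTEGER `q`-series near the cusp (`12·(b₂/12) = b₂ ∈ ℤ` for the globally
minimal `W`). [cite: Honda1970, Thm. 9] [cite: SilvermanAEC2009, IV.1] -/
theorem exists_hasSum_qParam_sq_mul_twelve_weierstrassP (W : WeierstrassCurve ℚ) [W.IsElliptic] [W.IsGloballyMinimal] {N : ℕ}
    [NeZero N] (D : ModularParametrizationData W N) :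
    ∃ (P : ℤ⟦X⟧) (B : ℝ), ∀ τ : ℍ, B < τ.im →
      HasSum (fun m : ℕ ↦ ((coeff m P : ℤ) : ℂ) * Function.Periodic.qParam 1 (τ : ℂ) ^ m)
        (Function.Periodic.qParam 1 (τ : ℂ) ^ 2 * (12 * ℘[D.L] (eichlerIntegral D.f τ))) := by
  classical
  obtain ⟨P, B, hP⟩ := exists_hasSum_qParam_sq_mul_x W D
  -- `b₂ ∈ ℤ`
  have hb₂ : (W.b₂ : ℂ) = (((integralModelInt W).b₂ : ℤ) : ℂ) := by
    have h : W.b₂ = ((integralModelInt W).b₂ : ℚ) := by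
      conv_lhs => rw [← map_integralModelInt W]
      rw [WeierstrassCurve.map_b₂]
      simp
    rw [h]
    push_cast
    rfl
  refine ⟨C (12 : ℤ) * P + C (integralModelInt W).b₂ * X ^ 2, B, fun τ hτ ↦ ?_⟩
  have h1 := (hP τ hτ).mul_left (12 : ℂ)
  have h2 : HasSum (fun m : ℕ ↦ ((coeff m (C (integralModelInt W).b₂ * X ^ 2 : ℤ⟦X⟧) : ℤ) : ℂ) *
      Function.Periodic.qParam 1 (τ : ℂ) ^ m) ((((integralModelInt W).b₂ : ℤ) : ℂ) * Function.Periodic.qParam 1 (τ : ℂ) ^ 2) := by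
    have h : HasSum (fun m : ℕ ↦ if m = 2 then (((integralModelInt W).b₂ : ℤ) : ℂ) * Function.Periodic.qParam 1 (τ : ℂ) ^ 2 else 0)
        ((((integralModelInt W).b₂ : ℤ) : ℂ) * Function.Periodic.qParam 1 (τ : ℂ) ^ 2) := hasSum_ite_eq 2 _
    convert h using 2 with m
    rw [coeff_C_mul, coeff_X_pow]
    split_ifs with hm
    · rw [hm]; push_cast; ring
    · simp
  have h := h1.add h2
  have hfun : (fun m : ℕ ↦ ((coeff m (C (12 : ℤ) * P + C (integralModelInt W).b₂ * X ^ 2) : ℤ) : ℂ) *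
      Function.Periodic.qParam 1 (τ : ℂ) ^ m) =
      fun m : ℕ ↦ 12 * (((coeff m P : ℤ) : ℂ) * Function.Periodic.qParam 1 (τ : ℂ) ^ m) +
        ((coeff m (C (integralModelInt W).b₂ * X ^ 2 : ℤ⟦X⟧) : ℤ) : ℂ) * Function.Periodic.qParam 1 (τ : ℂ) ^ m := by
    funext m
    rw [map_add, coeff_C_mul]
    push_cast
    ring
  have hval : Function.Periodic.qParam 1 (τ : ℂ) ^ 2 * (12 * ℘[D.L] (eichlerIntegral D.f τ)) =
      12 * (Function.Periodic.qParam 1 (τ : ℂ) ^ 2 * (℘[D.L] (eichlerIntegral D.f τ) - (W.b₂ : ℂ) / 12)) +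
        (((integralModelInt W).b₂ : ℤ) : ℂ) * Function.Periodic.qParam 1 (τ : ℂ) ^ 2 := by
    rw [hb₂]; ring
  rw [hfun, hval]
  exact h

end Summit.BirchSwinnertonDyer.BirchSwinnertonDyer.Theorems.ManinLocalTwoThree.CDivCuspGerm

end
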